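import Literature.Topology.FourManifolds.HandleAttachingMapOfTube
import Literature.Topology.FourManifolds.HandleAttachingMapsInversion
import Literature.Topology.FourManifolds.CorkDecompositionSplittingProof
import Literature.Topology.FourManifolds.ClosedBallTangent
import Literature.Topology.FourManifolds.GradientLike
import Literature.Geometry.Manifold.OpenSubmanifoldTangent
import Literature.Geometry.Manifold.OpenSubmanifoldMFDeriv
import Mathlib.Analysis.SpecialFunctions.SmoothTransition
import Mathlib.Analysis.SpecialFunctions.Sqrt
import Mathlib.Geometry.Manifold.IntegralCurve.Basic
import HarnessLib

/-!
# The depth field on Kosinski's tube `T` and the depth lines of an attaching map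

Topic `Literature/Topology/FourManifolds`; infrastructure for the isotopy invariance of
2-handle attachment (`Geometry/Symplectic/TwoHandleIsotopy.lean`, named fact
`HandleAttachingMap.isMultiAttachment_of_linkIsotopyInBoundary`), step *"independence of the
interior extension `h̄` of `h`"* (Kosinski, *Differential Manifolds* (1993), VI §5: the manifold
joined along submanifolds of the boundary *"depends on the choice of imbeddings `h₁, h₂`, but not
on the choice of extensions `h̄₁, h̄₂` … a version of the Uniqueness of Collars Theorem"*), which
is carried out by comparing **collars of `∂W` adapted to the attaching maps**: collars whose lines
through the sphere part `h̄(T ∩ ∂D⁴)` are the *depth lines* `s ↦ h̄ (y(s))` of `h̄`, where `y(s)`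
runs from a point `y(0)` of `T ∩ ∂D⁴` radially into `T` at depth `tubeDepth (y s) = s`
(`HandleAttachingMapOfTube.lean`: `tubeDepth y = 1 - ‖y‖²`, `mkVec θ v s`).  Such collars are
flow-outs (`BoundaryFlowout.lean`) of vector fields which near the attaching circles are the
velocity fields of the depth lines; this file constructs these velocity fields.

* `depthProfile`, `depthFieldAmb` — the ambient field `V(x) = -g(|x_λ|²) x_λ` on `ℝ⁴` (embedded
  `λ`-part), `g` smooth with `g(r) = 1/(2r)` for `r ≥ 1/2`; on `{|x_λ|² ≥ 1/2}` its integral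
  curves are the depth lines `s ↦ mkVec θ v s` (`hasDerivAt_mkVec`: `d/ds mkVec θ v s = V`);
* `depthField` — its pull-back to the manifold with boundary `D⁴` (`closedBallCoeDeriv`,
  `ClosedBallTangent.lean`), a smooth vector field on `D⁴` (`contMDiff_depthField`), and
  `depthFieldT`, its restriction to the open submanifold `T` (`OpenSubmanifold.contMDiff_tangentSection`);
* `depthLine θ v s : T` — the depth line through the sphere point of angle `θ` and fibre `v`, and
  `hasMFDerivWithinAt_depthLine`: it is an integral curve of `depthFieldT` while `|x_λ|² ≥ 1/2`;
* for an attaching map `f : HandleAttachingMap 3 2 W`: `f.toHomeo` (the partial homeomorphism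
  `T ⇀ W`, smooth inverse `contMDiffOn_toHomeo_symm`), the **depth function**
  `f.depthFun = tubeDepth ∘ f⁻¹` and the **depth field** `f.depthVF = f_* depthFieldT` on the
  range of `f` (smooth there, `contMDiffOn_depthVF`), with `f.depthVF (f.depthFun) = 1` near the
  attaching circle (`mlineDeriv_depthFun_depthVF`) and the depth lines `s ↦ f (depthLine θ v s)`
  as integral curves (`isMIntegralCurveOn_depthLine`), of depth `s` (`depthFun_depthLine`);
* `f.apply_mem_boundary_iff` — `f y ∈ ∂W ↔ ‖y‖ = 1` (open smooth embeddings preserve the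
  boundary, `mem_boundary_iff_of_isSmoothEmbedding`).

Everything here is proved; no named facts are introduced.

## References

* A. A. Kosinski, *Differential Manifolds*, Academic Press (1993), VI §5, §6. [Kosinski1993]
* J. Milnor, *Lectures on the h-cobordism theorem* (1965), proof of Thm. 3.4 (collars as
  flow-outs). [MilnorHCobordism1965]
-/

open scoped Manifold ContDiff Topology
open Set Function Metric Filter

noncomputable section

namespace Literature.Topology.FourManifolds

/-- Local notation: `𝔼 n` is the model Euclidean space `EuclideanSpace ℝ (Fin n)`. -/
local notation "𝔼 " n:arg => EuclideanSpace ℝ (Fin n)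

/-- Local notation: `𝕊 n` is the unit sphere in `EuclideanSpace ℝ (Fin (n + 1))`. -/
local notation "𝕊 " n:arg => (Metric.sphere (0 : EuclideanSpace ℝ (Fin (n + 1))) 1)

/-- Local notation: `𝔻 n` is the closed unit ball in `EuclideanSpace ℝ (Fin n)`. -/
local notation "𝔻 " n:arg => (Metric.closedBall (0 : EuclideanSpace ℝ (Fin n)) 1)

set_option quotPrecheck false in
/-- Local notation: Kosinski's tube `T ⊆ D⁴` of the circle `S¹ × 0`, as a type. -/
local notation "𝕋" => ↥(handleTube 3 2)

attribute [local instance] fact_finrank_euclideanSpace_succ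

/-! ### The radial profile and the ambient depth field -/

section Ambient

/-- The radial profile `g(r) = S(4r - 1) / (2r)` (`S` Mathlib's `Real.smoothTransition`): smooth
on `ℝ`, zero for `r ≤ 1/4`, equal to `1/(2r)` for `r ≥ 1/2`. [folklore] -/
def depthProfile (r : ℝ) : ℝ := Real.smoothTransition (4 * r - 1) * (2 * r)⁻¹

/-- `g(r) = 1/(2r)` for `r ≥ 1/2`. [folklore] -/
theorem depthProfile_of_le {r : ℝ} (hr : 1 / 2 ≤ r) : depthProfile r = (2 * r)⁻¹ := by
  rw [depthProfile, Real.smoothTransition.one_of_one_le (by linarith), one_mul]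

/-- `g(r) = 0` for `r ≤ 1/4`. [folklore] -/
theorem depthProfile_of_le_quarter {r : ℝ} (hr : r ≤ 1 / 4) : depthProfile r = 0 := by
  rw [depthProfile, Real.smoothTransition.zero_of_nonpos (by linarith), zero_mul]

/-- The radial profile is smooth. [folklore] -/
theorem contDiff_depthProfile : ContDiff ℝ ∞ depthProfile := by
  rw [contDiff_iff_contDiffAt]
  intro r
  rcases lt_or_ge (1 / 8 : ℝ) r with hr | hr
  · -- a product of smooth functions near `r > 1/8`
    have h1 : ContDiffAt ℝ ∞ (fun r : ℝ => Real.smoothTransition (4 * r - 1)) r :=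
      Real.smoothTransition.contDiff.contDiffAt.comp r
        ((contDiffAt_const.mul contDiffAt_id).sub contDiffAt_const)
    have h2 : ContDiffAt ℝ ∞ (fun r : ℝ => (2 * r)⁻¹) r :=
      (contDiffAt_const.mul contDiffAt_id).inv (by simp only [id_eq]; linarith)
    exact h1.mul h2
  · -- locally zero near `r ≤ 1/8`
    have hev : depthProfile =ᶠ[𝓝 r] fun _ => 0 := by
      have : Iio (1 / 4 : ℝ) ∈ 𝓝 r := Iio_mem_nhds (by linarith)
      filter_upwards [this] with r' hr'
      exact depthProfile_of_le_quarter (le_of_lt hr')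
    exact contDiffAt_const.congr_of_eventuallyEq hev

/-- **The ambient depth field** `V(x) = -g(|x_λ|²) (x_λ, 0)` on `ℝ⁴`. [folklore] -/
def depthFieldAmb (x : 𝔼 4) : 𝔼 4 := -(depthProfile (lamSq 2 x)) • lamEmbed (lamPart x)

/-- The ambient depth field is smooth. [folklore] -/
theorem contDiff_depthFieldAmb : ContDiff ℝ ∞ depthFieldAmb :=
  (contDiff_depthProfile.comp (contDiff_lamSq 2)).neg.smul (contDiff_lamEmbed.comp contDiff_lamPart)

/-- On `{|x_λ|² ≥ 1/2}` the depth field is `-(x_λ, 0)/(2|x_λ|²)`. [folklore] -/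
theorem depthFieldAmb_of_le {x : 𝔼 4} (hx : 1 / 2 ≤ lamSq 2 x) :
    depthFieldAmb x = -((2 * lamSq 2 x)⁻¹) • lamEmbed (lamPart x) := by
  rw [depthFieldAmb, depthProfile_of_le hx]

/-- **The depth lines are integral curves of the ambient depth field**: for a unit `θ`, fibre
`v` and depth `s` with `1 - s - ‖v‖² ≥ 1/2`, `d/ds mkVec θ v s = V (mkVec θ v s)`.  (The depth
line `s ↦ (1 - s - ‖v‖²)^{1/2} (θ, 0) + (0, v)` has velocity `-(θ, 0)/(2(1 - s - ‖v‖²)^{1/2})`.)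
[folklore] -/
theorem hasDerivAt_mkVec (θ : 𝕊 1) (v : 𝔼 2) {s : ℝ} (hs : 1 / 2 ≤ 1 - s - ‖v‖ ^ 2) :
    HasDerivAt (fun s => mkVec (θ : 𝔼 2) v s) (depthFieldAmb (mkVec (θ : 𝔼 2) v s)) s := by
  set u : ℝ := 1 - s - ‖v‖ ^ 2 with hu
  have hu0 : 0 < u := by linarith
  -- the derivative of the depth line
  have h1 : HasDerivAt (fun s : ℝ => 1 - s - ‖v‖ ^ 2) (-1) s := by
    simpa using ((hasDerivAt_const s (1 : ℝ)).sub (hasDerivAt_id s)).sub_const (‖v‖ ^ 2)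
  have h2 : HasDerivAt (fun s : ℝ => Real.sqrt (1 - s - ‖v‖ ^ 2)) (1 / (2 * Real.sqrt u) * (-1)) s :=
    (Real.hasDerivAt_sqrt hu0.ne').comp s h1
  have h3 : HasDerivAt (fun s => mkVec (θ : 𝔼 2) v s)
      ((1 / (2 * Real.sqrt u) * (-1)) • lamEmbed (θ : 𝔼 2)) s := by
    have := (h2.smul_const (lamEmbed (θ : 𝔼 2))).add_const (muEmbed v)
    simpa [mkVec] using this
  -- the value of the field on the depth line
  have hlam : lamSq 2 (mkVec (θ : 𝔼 2) v s) = u := lamSq_mkVec θ v hu0.le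
  have key : ∀ c w : ℝ, c ≠ 0 → c * c = w → -(2 * w)⁻¹ * c = 1 / (2 * c) * (-1) := by
    intro c w hc hw
    subst hw
    field_simp
  have hfield : depthFieldAmb (mkVec (θ : 𝔼 2) v s) =
      ((1 / (2 * Real.sqrt u) * (-1)) • lamEmbed (θ : 𝔼 2)) := by
    rw [depthFieldAmb_of_le (by rw [hlam]; exact hs), hlam, lamPart_mkVec, lamEmbed_smul, smul_smul]
    congr 1
    exact key _ _ (Real.sqrt_pos.2 hu0).ne' (Real.mul_self_sqrt hu0.le)
  rw [hfield]
  exact h3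

end Ambient

/-! ### The depth field on the manifold with boundary `D⁴` and on the tube `T` -/

section Ball

/-- **The depth field on `D⁴`**: the ambient depth field pulled back along the inclusion
`D⁴ ↪ ℝ⁴` (a tangent vector of `D⁴` read in the preferred chart, `closedBallCoeDeriv`).
[folklore] -/
def depthField (y : 𝔻 4) : TangentSpace (𝓡∂ 4) y :=
  (closedBallCoeDeriv y).symm (depthFieldAmb (y : 𝔼 4))

/-- The ambient representative of the depth field is the ambient depth field. [folklore] -/
theorem closedBallCoeDeriv_depthField (y : 𝔻 4) :
    closedBallCoeDeriv y (depthField y) = depthFieldAmb (y : 𝔼 4) :=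
  (closedBallCoeDeriv y).apply_symm_apply _

/-- **The depth field is a smooth vector field on `D⁴`** (smoothness of vector fields on the
ball is ambient smoothness, `contMDiff_tangentSection_iff_closedBall`). [folklore] -/
theorem contMDiff_depthField :
    ContMDiff (𝓡∂ 4) (𝓡∂ 4).tangent ∞
      (fun y => (Bundle.TotalSpace.mk' (𝔼 4) y (depthField y) : TangentBundle (𝓡∂ 4) (𝔻 4))) := by
  rw [contMDiff_tangentSection_iff_closedBall]
  have h : ContMDiff (𝓡∂ 4) 𝓘(ℝ, 𝔼 4) ∞ fun y : 𝔻 4 => depthFieldAmb (y : 𝔼 4) :=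
    contDiff_depthFieldAmb.contMDiff.comp (contMDiff_coe_closedBall (n := 3))
  exact h.congr fun y => closedBallCoeDeriv_depthField y

/-- **The depth field on the tube `T`** (restriction to the open submanifold; the tangent
spaces agree, `T_yT = T_yD⁴`). [folklore] -/
def depthFieldT (y : 𝕋) : TangentSpace (𝓡∂ 4) y := depthField (y : 𝔻 4)

/-- The depth field on `T` is a smooth vector field (`OpenSubmanifold.contMDiff_tangentSection`).
[folklore] -/
theorem contMDiff_depthFieldT :
    ContMDiff (𝓡∂ 4) (𝓡∂ 4).tangent ∞
      (fun y => (Bundle.TotalSpace.mk' (𝔼 4) y (depthFieldT y) : TangentBundle (𝓡∂ 4) 𝕋)) :=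
  Literature.Geometry.Manifold.OpenSubmanifold.contMDiff_tangentSection contMDiff_depthField
    (handleTube 3 2)

/-! ### Curves into `D⁴` and into `T`: reading derivatives ambiently -/

/-- **A curve in `D⁴` with an ambient derivative has the pulled-back manifold derivative**:
if `γ : ℝ → D⁴` is continuous within `s` at `t` and `t ↦ (γ t : ℝ⁴)` has derivative `v` within
`s` at `t`, then `γ` has manifold derivative `(closedBallCoeDeriv (γ t))⁻¹ v` within `s` at `t`
(the chart of `D⁴` at `γ t` is the restriction of the ambient chart, `extChartAt_closedBall_apply`,
whose derivative at the point is `(closedBallCoeDeriv (γ t))⁻¹`). [folklore] -/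
theorem hasMFDerivWithinAt_closedBall_of_hasDerivWithinAt {γ : ℝ → 𝔻 4} {s : Set ℝ} {t : ℝ}
    {v : 𝔼 4} (hc : ContinuousWithinAt γ s t)
    (hγ : HasDerivWithinAt (fun t => ((γ t : 𝔻 4) : 𝔼 4)) v s t) :
    HasMFDerivWithinAt 𝓘(ℝ, ℝ) (𝓡∂ 4) γ s t
      ((1 : ℝ →L[ℝ] ℝ).smulRight ((closedBallCoeDeriv (γ t)).symm v)) := by
  refine ⟨hc, ?_⟩
  have hw : writtenInExtChartAt 𝓘(ℝ, ℝ) (𝓡∂ 4) t γ =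
      fun t' => closedBallAmbChart (γ t) ((γ t' : 𝔻 4) : 𝔼 4) := by
    funext t'
    simp only [writtenInExtChartAt, extChartAt_model_space_eq_id, PartialEquiv.refl_symm,
      PartialEquiv.refl_coe, comp_apply, id_eq]
    exact extChartAt_closedBall_apply (γ t) (γ t')
  rw [hw]
  simp only [extChartAt_model_space_eq_id, PartialEquiv.refl_symm, PartialEquiv.refl_coe,
    preimage_id_eq, id_eq, modelWithCornersSelf_coe, range_id, inter_univ]
  have hA : HasFDerivAt (closedBallAmbChart (γ t))
      ((closedBallCoeDeriv (γ t)).symm : 𝔼 4 →L[ℝ] 𝔼 4) ((γ t : 𝔻 4) : 𝔼 4) := by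
    rw [coe_closedBallCoeDeriv_symm]
    exact hasFDerivAt_closedBallAmbChart (γ t) (coe_mem_closedBallAmbChart_source (γ t))
  have h := hA.comp_hasFDerivWithinAt t hγ.hasFDerivWithinAt
  have hL : ((closedBallCoeDeriv (γ t)).symm : 𝔼 4 →L[ℝ] 𝔼 4).comp
      (ContinuousLinearMap.toSpanSingleton ℝ v) =
      (1 : ℝ →L[ℝ] ℝ).smulRight ((closedBallCoeDeriv (γ t)).symm v) := by
    ext1
    simp
  have h' : HasFDerivWithinAt (fun t' => closedBallAmbChart (γ t) ((γ t' : 𝔻 4) : 𝔼 4))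
      ((1 : ℝ →L[ℝ] ℝ).smulRight ((closedBallCoeDeriv (γ t)).symm v)) s t := by
    rw [← hL]
    exact h
  exact h'

/-- **Curves into the open submanifold `T`**: a manifold derivative of `val ∘ γ : ℝ → D⁴`
within `s` at `t` is a manifold derivative of `γ : ℝ → T` (the charts of `T` are the
restrictions of those of `D⁴`, so the two written-in-charts expressions coincide). [folklore] -/
theorem hasMFDerivWithinAt_tube_of_val {γ : ℝ → 𝕋} {s : Set ℝ} {t : ℝ}
    {f' : TangentSpace 𝓘(ℝ, ℝ) t →L[ℝ] TangentSpace (𝓡∂ 4) (γ t)}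
    (h : HasMFDerivWithinAt 𝓘(ℝ, ℝ) (𝓡∂ 4) (fun t => (γ t : 𝔻 4)) s t f') :
    HasMFDerivWithinAt 𝓘(ℝ, ℝ) (𝓡∂ 4) γ s t f' := by
  refine ⟨?_, ?_⟩
  · exact (Topology.IsInducing.subtypeVal.continuousWithinAt_iff).2 h.1
  · exact h.2

/-! ### The depth lines in `T` -/

open Classical in
/-- **The depth line** through the sphere point of angle `θ` and fibre `v`: the point of `T`
with angle `θ`, fibre `v` and depth `s`, for `0 ≤ s` and `1 - s - ‖v‖² > 0` (junk: the circle
point of angle `θ`, otherwise). [folklore] -/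
def depthLine (θ : 𝕊 1) (v : 𝔼 2) (s : ℝ) : 𝕋 :=
  if h : 0 ≤ s ∧ 0 < 1 - s - ‖v‖ ^ 2 then mkTubePt θ v s h.1 h.2 else coreTubePt θ

/-- Unfolding the depth line on its natural domain. [folklore] -/
theorem depthLine_of (θ : 𝕊 1) (v : 𝔼 2) {s : ℝ} (hs : 0 ≤ s) (h : 0 < 1 - s - ‖v‖ ^ 2) :
    depthLine θ v s = mkTubePt θ v s hs h := by
  rw [depthLine, dif_pos ⟨hs, h⟩]

/-- The underlying vector of the depth line is `mkVec θ v s`. [folklore] -/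
theorem tubeVec_depthLine (θ : 𝕊 1) (v : 𝔼 2) {s : ℝ} (hs : 0 ≤ s) (h : 0 < 1 - s - ‖v‖ ^ 2) :
    tubeVec (depthLine θ v s) = mkVec (θ : 𝔼 2) v s := by
  rw [depthLine_of θ v hs h, tubeVec_mkTubePt]

/-- The depth of the depth line at parameter `s` is `s`. [folklore] -/
theorem tubeDepth_depthLine (θ : 𝕊 1) (v : 𝔼 2) {s : ℝ} (hs : 0 ≤ s) (h : 0 < 1 - s - ‖v‖ ^ 2) :
    tubeDepth (depthLine θ v s) = s := by
  rw [depthLine_of θ v hs h, tubeDepth_mkTubePt]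

/-- The fibre coordinate is constant `v` along the depth line. [folklore] -/
theorem tubeFibre_depthLine (θ : 𝕊 1) (v : 𝔼 2) {s : ℝ} (hs : 0 ≤ s) (h : 0 < 1 - s - ‖v‖ ^ 2) :
    tubeFibre (depthLine θ v s) = v := by
  rw [depthLine_of θ v hs h, tubeFibre_mkTubePt]

/-- The angle coordinate is constant `θ` along the depth line. [folklore] -/
theorem tubeAngle_depthLine (θ : 𝕊 1) (v : 𝔼 2) {s : ℝ} (hs : 0 ≤ s) (h : 0 < 1 - s - ‖v‖ ^ 2) :
    tubeAngle (depthLine θ v s) = θ := by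
  rw [depthLine_of θ v hs h, tubeAngle_mkTubePt]

/-- `|x_λ|²` along the depth line is `1 - s - ‖v‖²`. [folklore] -/
theorem lamSq_depthLine (θ : 𝕊 1) (v : 𝔼 2) {s : ℝ} (hs : 0 ≤ s) (h : 0 < 1 - s - ‖v‖ ^ 2) :
    lamSq 2 (tubeVec (depthLine θ v s)) = 1 - s - ‖v‖ ^ 2 := by
  rw [tubeVec_depthLine θ v hs h, lamSq_mkVec θ v h.le]

/-- **The depth line through a point of `T`**: the depth line with the angle and fibre of `y`
passes through `y` at parameter `tubeDepth y`. [folklore] -/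
theorem depthLine_tube (y : 𝕋) :
    depthLine (tubeAngle y) (tubeFibre y) (tubeDepth y) = y := by
  have h : 0 < 1 - tubeDepth y - ‖tubeFibre y‖ ^ 2 := by
    have := tubeDepth_add_norm_tubeFibre_sq_lt_one y; linarith
  rw [depthLine_of _ _ (tubeDepth_nonneg y) h, mkTubePt_tube]

/-- The depth line at depth `0` is a point of the sphere `∂D⁴`. [folklore] -/
theorem norm_tubeVec_depthLine_zero (θ : 𝕊 1) (v : 𝔼 2) :
    ‖tubeVec (depthLine θ v 0)‖ = 1 := by
  by_cases h : 0 < 1 - 0 - ‖v‖ ^ 2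
  · have h1 := norm_mkVec_sq θ v h.le
    rw [tubeVec_depthLine θ v le_rfl h]
    rw [sub_zero] at h1
    nlinarith [norm_nonneg (mkVec (θ : 𝔼 2) v 0)]
  · rw [depthLine, dif_neg (fun h' => h h'.2)]
    exact norm_corePt θ

/-- **The depth line is continuous on its natural domain** `[0, 1 - ‖v‖²)`, indeed smooth as a
map into `T` there: within `[0, b]`, `b < 1 - ‖v‖²`, it is continuous at every point.
[folklore] -/
theorem continuousWithinAt_depthLine (θ : 𝕊 1) (v : 𝔼 2) {b t : ℝ} (hb : b < 1 - ‖v‖ ^ 2)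
    (ht : t ∈ Icc 0 b) : ContinuousWithinAt (depthLine θ v) (Icc 0 b) t := by
  -- on `[0, b]` the depth line is the smooth map `s ↦ mkTubePt θ v s`
  have hpos : ∀ s ∈ Icc (0 : ℝ) b, 0 < 1 - s - ‖v‖ ^ 2 := fun s hs => by linarith [hs.2]
  have hvec : ContMDiffOn 𝓘(ℝ, ℝ) 𝓘(ℝ, 𝔼 4) ∞ (fun s : ℝ => mkVec (θ : 𝔼 2) v s) (Icc 0 b) :=
    contMDiffOn_mkVec contMDiffOn_const contMDiffOn_const contMDiff_id.contMDiffOn hpos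
  have hcont : ContinuousOn (fun s : ℝ => mkVec (θ : 𝔼 2) v s) (Icc 0 b) := hvec.continuousOn
  have h1 : ContinuousWithinAt (fun s => tubeVec (depthLine θ v s)) (Icc 0 b) t := by
    refine (hcont t ht).congr (fun s hs => ?_) ?_
    · exact tubeVec_depthLine θ v hs.1 (hpos s hs)
    · exact tubeVec_depthLine θ v ht.1 (hpos t ht)
  -- `tubeVec = val ∘ val` is an embedding
  have h2 : ContinuousWithinAt (fun s => (depthLine θ v s : 𝔻 4)) (Icc 0 b) t :=
    (Topology.IsInducing.subtypeVal.continuousWithinAt_iff).2 h1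
  exact (Topology.IsInducing.subtypeVal.continuousWithinAt_iff).2 h2

/-- **The depth lines are integral curves of the depth field on `T` while `|x_λ|² ≥ 1/2`**: for
`b` with `1 - b - ‖v‖² ≥ 1/2` (so all depths `s ∈ [0, b]` have `|x_λ|² ≥ 1/2`) and `t ∈ [0, b]`,
the depth line has manifold derivative `depthFieldT` within `[0, b]` at `t`. [folklore] -/
theorem hasMFDerivWithinAt_depthLine (θ : 𝕊 1) (v : 𝔼 2) {b t : ℝ}
    (hb : 1 / 2 ≤ 1 - b - ‖v‖ ^ 2) (ht : t ∈ Icc 0 b) :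
    HasMFDerivWithinAt 𝓘(ℝ, ℝ) (𝓡∂ 4) (depthLine θ v) (Icc 0 b) t
      ((1 : ℝ →L[ℝ] ℝ).smulRight (depthFieldT (depthLine θ v t))) := by
  have hb' : b < 1 - ‖v‖ ^ 2 := by linarith
  have hpos : ∀ s ∈ Icc (0 : ℝ) b, 0 < 1 - s - ‖v‖ ^ 2 := fun s hs => by linarith [hs.2]
  apply hasMFDerivWithinAt_tube_of_val
  -- the ambient derivative of the depth line within `[0, b]`
  have hamb : HasDerivWithinAt (fun s => (((depthLine θ v s : 𝔻 4)) : 𝔼 4))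
      (depthFieldAmb (mkVec (θ : 𝔼 2) v t)) (Icc 0 b) t := by
    have h := (hasDerivAt_mkVec θ v (s := t) (by linarith [ht.2])).hasDerivWithinAt (s := Icc 0 b)
    refine h.congr (fun s hs => ?_) ?_
    · exact tubeVec_depthLine θ v hs.1 (hpos s hs)
    · exact tubeVec_depthLine θ v ht.1 (hpos t ht)
  have hc : ContinuousWithinAt (fun s => (depthLine θ v s : 𝔻 4)) (Icc 0 b) t :=
    (Topology.IsInducing.subtypeVal.continuousWithinAt_iff).1 (continuousWithinAt_depthLine θ v hb' ht)
  have key := hasMFDerivWithinAt_closedBall_of_hasDerivWithinAt hc hamb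
  have hval : depthFieldT (depthLine θ v t) =
      (closedBallCoeDeriv (depthLine θ v t : 𝔻 4)).symm (depthFieldAmb (mkVec (θ : 𝔼 2) v t)) := by
    rw [depthFieldT, depthField]
    congr 1
    exact congrArg depthFieldAmb (tubeVec_depthLine θ v ht.1 (hpos t ht))
  rw [hval]
  exact key

/-- **The depth has unit derivative along the depth field** where `|x_λ|² > 1/2`:
`d(tubeDepth)(depthFieldT y) = 1` (differentiate `tubeDepth (depthLine s) = s` along the depth
line through `y`). [folklore] -/
theorem mfderiv_tubeDepth_depthFieldT (y : 𝕋) (hy : 1 / 2 < lamSq 2 (tubeVec y)) :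
    mfderiv (𝓡∂ 4) 𝓘(ℝ, ℝ) tubeDepth y (depthFieldT y) = 1 := by
  -- the depth line through `y`, on `[0, b]` with `b` slightly above `tubeDepth y`
  set θ := tubeAngle y with hθ_def
  set v := tubeFibre y with hv_def
  set t := tubeDepth y with ht_def
  have hrel : 1 - t - ‖v‖ ^ 2 = lamSq 2 (tubeVec y) := by
    rw [← norm_lamPart_sq, norm_lamPart_sq_eq]
  obtain ⟨b, htb, hb⟩ : ∃ b, t < b ∧ 1 / 2 ≤ 1 - b - ‖v‖ ^ 2 :=
    ⟨t + (lamSq 2 (tubeVec y) - 1 / 2) / 2, by linarith, by linarith⟩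
  have ht : t ∈ Icc 0 b := ⟨tubeDepth_nonneg y, htb.le⟩
  have hpos : ∀ s ∈ Icc (0 : ℝ) b, 0 < 1 - s - ‖v‖ ^ 2 := fun s hs => by linarith [hs.2]
  have hline := hasMFDerivWithinAt_depthLine θ v hb ht
  -- chain rule along the depth line
  have hd : HasMFDerivAt (𝓡∂ 4) 𝓘(ℝ, ℝ) tubeDepth (depthLine θ v t)
      (mfderiv (𝓡∂ 4) 𝓘(ℝ, ℝ) tubeDepth (depthLine θ v t)) :=
    (contMDiff_tubeDepth.mdifferentiableAt (by simp)).hasMFDerivAt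
  have hcomp := hd.comp_hasMFDerivWithinAt t hline
  -- `tubeDepth ∘ depthLine = id` on `[0, b]`
  have hid : HasMFDerivWithinAt 𝓘(ℝ, ℝ) 𝓘(ℝ, ℝ) (tubeDepth ∘ depthLine θ v) (Icc 0 b) t
      (ContinuousLinearMap.id ℝ ℝ) := by
    refine (hasMFDerivWithinAt_id (Icc (0 : ℝ) b) t).congr_of_eventuallyEq ?_ ?_
    · filter_upwards [self_mem_nhdsWithin] with s hs
      exact tubeDepth_depthLine θ v hs.1 (hpos s hs)
    · exact tubeDepth_depthLine θ v ht.1 (hpos t ht)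
  have huniq : UniqueMDiffWithinAt 𝓘(ℝ, ℝ) (Icc 0 b) t := by
    rw [uniqueMDiffWithinAt_iff_uniqueDiffWithinAt]
    exact uniqueDiffOn_Icc (lt_of_le_of_lt (tubeDepth_nonneg y) htb) t ht
  have heq := huniq.eq hcomp hid
  rw [depthLine_tube y] at heq
  have h1 := ContinuousLinearMap.ext_iff.1 heq (1 : ℝ)
  have h2 : ((mfderiv (𝓡∂ 4) 𝓘(ℝ, ℝ) tubeDepth y).comp
      ((1 : ℝ →L[ℝ] ℝ).smulRight (depthFieldT y))) (1 : ℝ) =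
      mfderiv (𝓡∂ 4) 𝓘(ℝ, ℝ) tubeDepth y (depthFieldT y) := by
    change mfderiv (𝓡∂ 4) 𝓘(ℝ, ℝ) tubeDepth y ((1 : ℝ) • depthFieldT y) = _
    rw [one_smul]
  calc mfderiv (𝓡∂ 4) 𝓘(ℝ, ℝ) tubeDepth y (depthFieldT y)
      = ((mfderiv (𝓡∂ 4) 𝓘(ℝ, ℝ) tubeDepth y).comp
          ((1 : ℝ →L[ℝ] ℝ).smulRight (depthFieldT y))) (1 : ℝ) := h2.symm
    _ = (ContinuousLinearMap.id ℝ ℝ) (1 : ℝ) := h1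
    _ = 1 := rfl

end Ball

/-! ### The depth function and the depth field of an attaching map -/

namespace HandleAttachingMap

variable {W : Type*} [TopologicalSpace W] [ChartedSpace (EuclideanHalfSpace 4) W]

set_option quotPrecheck false in
/-- Local notation: the boundary 3-manifold `∂W` of `W`, as a type. -/
local notation "∂𝕎" => ↥((𝓡∂ 4).boundary W)

variable (f : HandleAttachingMap 3 2 W)

/-- The tube `T` is nonempty (it contains the attaching circle). [folklore] -/
instance instNonemptyHandleTube : Nonempty 𝕋 :=
  ⟨coreTubePt ⟨EuclideanSpace.single (0 : Fin 2) 1, by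
    rw [mem_sphere_zero_iff_norm]; exact norm_single_zero_one⟩⟩

/-- An attaching map is an open embedding. [folklore] -/
theorem isOpenEmbedding : Topology.IsOpenEmbedding f.toFun :=
  ⟨f.isSmoothEmbedding.isEmbedding, f.isOpen_range⟩

/-- **The attaching map as a partial homeomorphism `T ⇀ W`** (source everything, target its
open range). [folklore] -/
def toHomeo : OpenPartialHomeomorph 𝕋 W :=
  f.isOpenEmbedding.toOpenPartialHomeomorph _

/-- The partial homeomorphism is `f` as a function. [folklore] -/
@[simp] theorem toHomeo_apply (y : 𝕋) : f.toHomeo y = f.toFun y := rfl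

/-- The partial homeomorphism of `f` is defined everywhere. [folklore] -/
@[simp] theorem toHomeo_source : f.toHomeo.source = univ := by simp [toHomeo]

/-- The target of the partial homeomorphism of `f` is the range of `f`. [folklore] -/
@[simp] theorem toHomeo_target : f.toHomeo.target = range f.toFun := by simp [toHomeo]

/-- The inverse is a left inverse of `f`. [folklore] -/
@[simp] theorem toHomeo_symm_apply (y : 𝕋) : f.toHomeo.symm (f.toFun y) = y :=
  f.isOpenEmbedding.toOpenPartialHomeomorph_left_inv

/-- `f ∘ f⁻¹ = id` on the range. [folklore] -/
theorem apply_toHomeo_symm {z : W} (hz : z ∈ range f.toFun) : f.toFun (f.toHomeo.symm z) = z := by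
  have h := f.toHomeo.right_inv (show z ∈ f.toHomeo.target by rwa [f.toHomeo_target])
  simpa using h

/-- **The inverse of an attaching map is smooth on its range** (inverse function theorem for
the open smooth embedding `f`, `contMDiffOn_symm_of_isSmoothEmbedding`). [folklore] -/
theorem contMDiffOn_toHomeo_symm : ContMDiffOn (𝓡∂ 4) (𝓡∂ 4) ∞ f.toHomeo.symm (range f.toFun) :=
  contMDiffOn_symm_of_isSmoothEmbedding f.isSmoothEmbedding f.isOpenEmbedding

/-- The inverse of `f` is `C^∞` at the points of the range. [folklore] -/
theorem contMDiffAt_toHomeo_symm {z : W} (hz : z ∈ range f.toFun) :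
    ContMDiffAt (𝓡∂ 4) (𝓡∂ 4) ∞ f.toHomeo.symm z :=
  f.contMDiffOn_toHomeo_symm.contMDiffAt (f.isOpen_range.mem_nhds hz)

/-- **An attaching map meets `∂W` exactly along the sphere part of `T`**: `f y ∈ ∂W ↔ ‖y‖ = 1`
(open smooth embeddings preserve boundary points, `mem_boundary_iff_of_isSmoothEmbedding`; the
boundary of the open submanifold `T ⊆ D⁴` is its trace on `∂D⁴ = S³`, `mem_boundary_opens_iff`,
`boundary_closedBall`). [folklore] -/
theorem apply_mem_boundary_iff (y : 𝕋) :
    f.toFun y ∈ (𝓡∂ 4).boundary W ↔ ‖tubeVec y‖ = 1 := by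
  rw [mem_boundary_iff_of_isSmoothEmbedding f.isSmoothEmbedding f.isOpen_range y,
    mem_boundary_opens_iff, boundary_closedBall]
  rfl

/-- Points of `T` of norm `< 1` go to interior points of `W`. [folklore] -/
theorem isInteriorPoint_apply {y : 𝕋} (hy : ‖tubeVec y‖ < 1) :
    (𝓡∂ 4).IsInteriorPoint (f.toFun y) := by
  change f.toFun y ∈ (𝓡∂ 4).interior W
  rw [← ModelWithCorners.compl_boundary, mem_compl_iff, f.apply_mem_boundary_iff]
  exact hy.ne

open Classical in
/-- **The depth function of an attaching map**: `tubeDepth ∘ f⁻¹` on the range of `f` (junk `1`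
elsewhere). [folklore] -/
def depthFun (z : W) : ℝ := if z ∈ range f.toFun then tubeDepth (f.toHomeo.symm z) else 1

/-- `depthFun f (f y) = tubeDepth y`. [folklore] -/
@[simp] theorem depthFun_apply (y : 𝕋) : f.depthFun (f.toFun y) = tubeDepth y := by
  rw [depthFun, if_pos (mem_range_self y), toHomeo_symm_apply]

/-- The depth function is smooth on the range of `f`. [folklore] -/
theorem contMDiffOn_depthFun : ContMDiffOn (𝓡∂ 4) 𝓘(ℝ, ℝ) ∞ f.depthFun (range f.toFun) := by
  have h : ContMDiffOn (𝓡∂ 4) 𝓘(ℝ, ℝ) ∞ (fun z => tubeDepth (f.toHomeo.symm z)) (range f.toFun) :=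
    contMDiff_tubeDepth.comp_contMDiffOn f.contMDiffOn_toHomeo_symm
  exact h.congr fun z hz => by rw [depthFun, if_pos hz]

/-- The depth function vanishes exactly at the boundary points of the range. [folklore] -/
theorem depthFun_apply_eq_zero_iff (y : 𝕋) :
    f.depthFun (f.toFun y) = 0 ↔ f.toFun y ∈ (𝓡∂ 4).boundary W := by
  rw [depthFun_apply, tubeDepth_eq_zero_iff, apply_mem_boundary_iff]

/-- The depth function is nonnegative. [folklore] -/
theorem depthFun_nonneg (z : W) : 0 ≤ f.depthFun z := by
  by_cases hz : z ∈ range f.toFun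
  · obtain ⟨y, rfl⟩ := hz
    rw [depthFun_apply]; exact tubeDepth_nonneg y
  · rw [depthFun, if_neg hz]; exact zero_le_one

open Classical in
/-- **The depth field of an attaching map**: the push-forward `f_* (depthFieldT)` on the range
of `f` (zero elsewhere). [folklore] -/
def depthVF (z : W) : TangentSpace (𝓡∂ 4) z :=
  if z ∈ range f.toFun then
    mfderiv (𝓡∂ 4) (𝓡∂ 4) f.toFun (f.toHomeo.symm z) (depthFieldT (f.toHomeo.symm z))
  else 0

/-- `depthVF f (f y) = df_y (depthFieldT y)`. [folklore] -/
theorem depthVF_apply (y : 𝕋) :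
    f.depthVF (f.toFun y) = mfderiv (𝓡∂ 4) (𝓡∂ 4) f.toFun y (depthFieldT y) := by
  rw [depthVF, if_pos (mem_range_self y), toHomeo_symm_apply]

/-- **The depth field of an attaching map is smooth on the range of `f`**: there it is the
tangent map of `f` applied to the smooth section `depthFieldT` transported by `f⁻¹`. [folklore] -/
theorem contMDiffOn_depthVF [IsManifold (𝓡∂ 4) ∞ W] :
    ContMDiffOn (𝓡∂ 4) (𝓡∂ 4).tangent ∞
      (fun z => (Bundle.TotalSpace.mk' (𝔼 4) z (f.depthVF z) : TangentBundle (𝓡∂ 4) W))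
      (range f.toFun) := by
  have hT : ContMDiff (𝓡∂ 4).tangent (𝓡∂ 4).tangent ∞ (tangentMap (𝓡∂ 4) (𝓡∂ 4) f.toFun) :=
    f.isSmoothEmbedding.contMDiff.contMDiff_tangentMap (m := ∞) (by norm_cast)
  have h1 : ContMDiffOn (𝓡∂ 4) (𝓡∂ 4).tangent ∞
      (fun z => tangentMap (𝓡∂ 4) (𝓡∂ 4) f.toFun
        (Bundle.TotalSpace.mk' (𝔼 4) (f.toHomeo.symm z) (depthFieldT (f.toHomeo.symm z))))
      (range f.toFun) :=
    hT.comp_contMDiffOn (contMDiff_depthFieldT.comp_contMDiffOn f.contMDiffOn_toHomeo_symm)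
  refine h1.congr fun z hz => ?_
  obtain ⟨y, rfl⟩ := hz
  rw [depthVF_apply, tangentMap, toHomeo_symm_apply]

/-! ### The depth lines of an attaching map -/

/-- The depth function along the depth lines of `f`: `depthFun f (f (depthLine θ v s)) = s`.
[folklore] -/
theorem depthFun_depthLine (θ : 𝕊 1) (v : 𝔼 2) {s : ℝ} (hs : 0 ≤ s) (h : 0 < 1 - s - ‖v‖ ^ 2) :
    f.depthFun (f.toFun (depthLine θ v s)) = s := by
  rw [depthFun_apply, tubeDepth_depthLine θ v hs h]

/-- **The depth lines of `f` are integral curves of its depth field** while `|x_λ|² ≥ 1/2`: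
for `1 - b - ‖v‖² ≥ 1/2`, the curve `s ↦ f (depthLine θ v s)` is an integral curve of
`depthVF f` on `[0, b]`. [folklore] -/
theorem isMIntegralCurveOn_depthLine (θ : 𝕊 1) (v : 𝔼 2) {b : ℝ}
    (hb : 1 / 2 ≤ 1 - b - ‖v‖ ^ 2) :
    IsMIntegralCurveOn (fun s => f.toFun (depthLine θ v s)) f.depthVF (Icc 0 b) := by
  intro t ht
  have hline := hasMFDerivWithinAt_depthLine θ v hb ht
  have hd : HasMFDerivAt (𝓡∂ 4) (𝓡∂ 4) f.toFun (depthLine θ v t)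
      (mfderiv (𝓡∂ 4) (𝓡∂ 4) f.toFun (depthLine θ v t)) :=
    (f.isSmoothEmbedding.contMDiff.mdifferentiableAt (by simp)).hasMFDerivAt
  have h := hd.comp_hasMFDerivWithinAt t hline
  have hL : (mfderiv (𝓡∂ 4) (𝓡∂ 4) f.toFun (depthLine θ v t)).comp
      ((1 : ℝ →L[ℝ] ℝ).smulRight (depthFieldT (depthLine θ v t))) =
      (1 : ℝ →L[ℝ] ℝ).smulRight (f.depthVF (f.toFun (depthLine θ v t))) := by
    rw [depthVF_apply]
    ext1
    simp
  rw [← hL]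
  exact h

/-- **The depth function has unit derivative along the depth field** near the attaching
circle: `d(depthFun f)(depthVF f) = 1` at `f y` whenever `|x_λ|²(y) > 1/2`. [folklore] -/
theorem mlineDeriv_depthFun_depthVF [IsManifold (𝓡∂ 4) ∞ W] (y : 𝕋) (hy : 1 / 2 < lamSq 2 (tubeVec y)) :
    mlineDeriv (𝓡∂ 4) f.depthFun (f.toFun y) (f.depthVF (f.toFun y)) = 1 := by
  rw [mlineDeriv_def, depthVF_apply]
  -- `depthFun f ∘ f = tubeDepth` near `y`, so `d(depthFun f)_{f y} ∘ df_y = d(tubeDepth)_y`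
  have hdf : MDifferentiableAt (𝓡∂ 4) 𝓘(ℝ, ℝ) f.depthFun (f.toFun y) :=
    (f.contMDiffOn_depthFun.contMDiffAt (f.isOpen_range.mem_nhds (mem_range_self y))).mdifferentiableAt
      (by simp)
  have hf : MDifferentiableAt (𝓡∂ 4) (𝓡∂ 4) f.toFun y :=
    f.isSmoothEmbedding.contMDiff.mdifferentiableAt (by simp)
  have hcomp := mfderiv_comp y hdf hf
  have heq : f.depthFun ∘ f.toFun = tubeDepth := funext fun y => f.depthFun_apply y
  rw [heq] at hcomp
  calc mfderiv (𝓡∂ 4) 𝓘(ℝ, ℝ) f.depthFun (f.toFun y)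
        (mfderiv (𝓡∂ 4) (𝓡∂ 4) f.toFun y (depthFieldT y))
      = ((mfderiv (𝓡∂ 4) 𝓘(ℝ, ℝ) f.depthFun (f.toFun y)).comp
          (mfderiv (𝓡∂ 4) (𝓡∂ 4) f.toFun y)) (depthFieldT y) := rfl
    _ = mfderiv (𝓡∂ 4) 𝓘(ℝ, ℝ) tubeDepth y (depthFieldT y) :=
        congrArg (fun L => L (depthFieldT y)) hcomp.symm
    _ = 1 := mfderiv_tubeDepth_depthFieldT y hy

end HandleAttachingMap

end Literature.Topology.FourManifolds

end
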